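import Summits.QuantumFields.BalabanUV.T4Continuum.Support.SubstrateComplexAvgTower

/-!
# SUBSTRATE — W-24c-β = LIBRARY L-E18b PART 2β, typer (π3)∕(π6) (`HOME/CLAIMS.log` l.23334 ∕ l.23452 ∕ l.23566): THE DEPTH DISC —
# after an EXISTENTIAL rescaling of the direction `H ↦ r•H`, the tower chart coordinate `z ↦ towerCoord P ℰ ι U (r•H) z` of the complex
# (0.4) averaging tower of the fine-field slice is HOLOMORPHIC ON THE UNIT DISC, CONTINUOUS ON ITS CLOSURE, VANISHES AT `0`, and maps the
# closed unit disc into any prescribed ball `ball 0 ϱ` — W-22′'s letters (1), (2′), (3) for ONE centre, at the averaging of record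

Cell `pub-balaban`, SUBSTRATE cell, seat `b2b-balaban-substrate-p4` (gen 5; owner of β per typer (π3)).  Summits-side under the LEAN PLACEMENT RULE.
HONEST FRAMING: rung (B)+1 of the FINITE-VOLUME T⁴ programme — NOT infinite volume, NOT a mass gap, NOT Clay; spine PROVED 0∕9; [folklore]
complex analysis (an analytic germ restricted to a small disc) on top of α's CONSTRUCTION; nothing of [Balaban1985Averaging] ∕ [Balaban1987RG1]
is asserted; the radius `r` is EXISTENTIAL (continuity at `0`) — a quantitative radius is letter (5) «reach», NE-side, NOT here; NO estimate of
any NE row.  HONEST DEPENDENCY (cell line, verbatim): continuum YM on T⁴ ⇐ BetaPertH ∧ nine spine estimates (0/9 proved); BetaPertH ⇐ (D1) ∧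
(D4) ∧ CAP+tail; G-an2-4 gates asym, D1 and NE2/3/4.

WHAT (imports α = `SubstrateComplexAvgTower` (p1 g7) ONLY; theorems only; nothing existing is modified):
* §1 [folklore] `exists_rescale_of_analyticAt_zero`: an `F`-valued germ `f` analytic at `0` with `f 0 = 0` restricts, after `z ↦ r·z` for some
  `r > 0`, to a map that is `DiffContOnCl ℂ` on `ball 0 1` and sends `closedBall 0 1` into `ball 0 ϱ` (any `ϱ > 0`).
* §2 reparametrisation: `sliceR_smul` ∕ `sliceS_smul` ∕ `towerSlice_smul` ∕ **`towerCoord_smul`** — scaling the direction IS scaling the parameter: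
  `towerCoord P ℰ ι U (r • H) z = towerCoord P ℰ ι U H (r * z)`.
* §3 **`exists_rescale_towerCoord`** (+ `_SU`): under α's displayed hypotheses (`ℰ.δ ≤ 1∕3`, unitary `ι` realising `dist1`, `hE`, levelwise `Small`),
  for every `ϱ > 0` there is `r > 0` with `towerCoord … (r•H) 0 = 0`, `DiffContOnCl ℂ (towerCoord … (r•H)) (ball 0 1)` and
  `MapsTo (towerCoord … (r•H)) (closedBall 0 1) (ball 0 ϱ)`; the quantitative companion `norm_towerCoord_le_two_mul` (W-24a
  `norm_logChartT_le_two_mul_norm_sub` at the unitary tower of record).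
NOT IN THIS FILE (W-24d ∕ later): letter (4) «real tie at real `z ≠ 0`» (needs `exp (t•H b) ∈ ι(G)`, i.e. `H_b ∈ 𝔰𝔲(n)` — typed with the
inhabitant), letter (5) «reach» (a quantitative radius), the `FineFieldChart` inhabitant itself (W-24d, p2 g6).
-/

noncomputable section

open scoped Matrix.Norms.L2Operator BigOperators
open Metric Set

namespace Summit.QuantumFields.BalabanUV.T4Continuum.SubstrateComplexAvgTowerDisc

open Literature.MathematicalPhysics.QuantumFieldTheory.Balaban1983to89
open Literature.MathematicalPhysics.QuantumFieldTheory.Balaban1983to89.BlockAveraging (blockAvg Small)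
open Literature.MathematicalPhysics.QuantumFieldTheory.Balaban1983to89.ExpMeanLog (eml expMeanLogSU)
open Literature.MathematicalPhysics.QuantumLattice (fundamentalRep fundamentalRep_mem_unitaryGroup)
open Summit.QuantumFields.BalabanUV.T4Continuum.SubstrateTransporterSpecies (TowerData towerDataOf)
open Summit.QuantumFields.BalabanUV.T4Continuum.SubstrateExpChartLog (logChartT norm_logChartT_le_two_mul_norm_sub)
open Summit.QuantumFields.BalabanUV.T4Continuum.SubstrateComplexBlockAvg (sliceR sliceS fundamentalRep_expMeanLogSU_E)
open Summit.QuantumFields.BalabanUV.T4Continuum.SubstrateComplexAvgTower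

/-! ## §1 Rescaling an analytic germ onto the unit disc -/

section Germ

variable {F : Type*} [NormedAddCommGroup F] [NormedSpace ℂ F] [CompleteSpace F]

/-- [folklore] **AN ANALYTIC GERM AT `0` WITH VALUE `0`, RESCALED ONTO THE UNIT DISC**: if `f` is analytic at `0` and `f 0 = 0`, then for every
`ϱ > 0` some rescaling `z ↦ f (r·z)`, `r > 0`, is ℂ-differentiable on the open unit disc, continuous on its closure, and maps the CLOSED unit
disc into `ball 0 ϱ` (analyticity propagates to a neighbourhood — `AnalyticAt.eventually_analyticAt` — and `f` is continuous at `0`). -/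
theorem exists_rescale_of_analyticAt_zero {f : ℂ → F} (hf : AnalyticAt ℂ f 0) (h0 : f 0 = 0) {ϱ : ℝ} (hϱ : 0 < ϱ) :
    ∃ r : ℝ, 0 < r ∧ DiffContOnCl ℂ (fun z : ℂ => f (r * z)) (ball 0 1) ∧ MapsTo (fun z : ℂ => f (r * z)) (closedBall 0 1) (ball 0 ϱ) := by
  obtain ⟨ε₁, hε₁, h₁⟩ := Metric.eventually_nhds_iff.1 hf.eventually_analyticAt
  have hc : ContinuousAt f 0 := hf.continuousAt
  obtain ⟨ε₂, hε₂, h₂⟩ := Metric.continuousAt_iff.1 hc ϱ hϱ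
  refine ⟨min ε₁ ε₂ / 2, by positivity, ?_, ?_⟩
  · -- differentiable on the closed disc, hence `DiffContOnCl` on the open one
    have hsmall : ∀ z ∈ closedBall (0 : ℂ) 1, dist (((min ε₁ ε₂ / 2 : ℝ) : ℂ) * z) 0 < ε₁ := by
      intro z hz
      rw [mem_closedBall, dist_zero_right] at hz
      rw [dist_zero_right, norm_mul, Complex.norm_real, Real.norm_of_nonneg (by positivity)]
      calc min ε₁ ε₂ / 2 * ‖z‖ ≤ min ε₁ ε₂ / 2 * 1 := by gcongr
        _ < ε₁ := by linarith [min_le_left ε₁ ε₂]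
    have hd : DifferentiableOn ℂ (fun z : ℂ => f ((min ε₁ ε₂ / 2 : ℝ) * z)) (closedBall 0 1) := fun z hz =>
      (((h₁ (hsmall z hz)).differentiableAt).comp z ((differentiableAt_const _).mul differentiableAt_id)).differentiableWithinAt
    exact DifferentiableOn.diffContOnCl (by rwa [closure_ball (0 : ℂ) one_ne_zero])
  · intro z hz
    rw [mem_closedBall, dist_zero_right] at hz
    have hlt : dist (((min ε₁ ε₂ / 2 : ℝ) : ℂ) * z) 0 < ε₂ := by
      rw [dist_zero_right, norm_mul, Complex.norm_real, Real.norm_of_nonneg (by positivity)]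
      calc min ε₁ ε₂ / 2 * ‖z‖ ≤ min ε₁ ε₂ / 2 * 1 := by gcongr
        _ < ε₂ := by linarith [min_le_right ε₁ ε₂]
    have h := h₂ hlt
    rw [h0, dist_zero_right] at h
    show f _ ∈ ball (0 : F) ϱ
    rwa [mem_ball, dist_zero_right]

end Germ

/-! ## §2 Scaling the direction is scaling the parameter -/

section Smul

variable {P : Params} {o : Type*} [Fintype o] [DecidableEq o] {G : Type*} [GaugeGroup G] (ι : G →* Matrix o o ℂ)

/-- [folklore] `sliceR` along `r • H` at `z` is `sliceR` along `H` at `r·z`. -/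
theorem sliceR_smul (U : GaugeField P 0 G) (H : PBond P 0 → Matrix o o ℂ) (r : ℝ) (z : ℂ) :
    sliceR ι U (fun b => (r : ℂ) • H b) z = sliceR ι U H ((r : ℂ) * z) := by
  funext b; simp only [sliceR, smul_smul, mul_comm z]

/-- [folklore] `sliceS` along `r • H` at `z` is `sliceS` along `H` at `r·z`. -/
theorem sliceS_smul (U : GaugeField P 0 G) (H : PBond P 0 → Matrix o o ℂ) (r : ℝ) (z : ℂ) :
    sliceS ι U (fun b => (r : ℂ) • H b) z = sliceS ι U H ((r : ℂ) * z) := by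
  funext b; simp only [sliceS, smul_smul, mul_comm z]

variable (P)

/-- [folklore] The slice towers along `r • H` at `z` are those along `H` at `r·z`. -/
theorem towerSlice_smul (U : GaugeField P 0 G) (H : PBond P 0 → Matrix o o ℂ) (r : ℝ) (z : ℂ) :
    towerSlice P ι U (fun b => (r : ℂ) • H b) z = towerSlice P ι U H ((r : ℂ) * z) := by
  rw [towerSlice, towerSlice, sliceR_smul, sliceS_smul]

/-- [folklore] **SCALING THE DIRECTION IS SCALING THE PARAMETER**: `towerCoord P ℰ ι U (r • H) z = towerCoord P ℰ ι U H (r·z)`. -/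
theorem towerCoord_smul (ℰ : LoopAverage G) (U : GaugeField P 0 G) (H : PBond P 0 → Matrix o o ℂ) (r : ℝ) (z : ℂ) :
    towerCoord P ℰ ι U (fun b => (r : ℂ) • H b) z = towerCoord P ℰ ι U H ((r : ℂ) * z) := by
  rw [towerCoord, towerCoord, towerSlice_smul]

end Smul

/-! ## §3 The depth disc: letters (1), (2′), (3) at one centre after rescaling the direction -/

section Disc

variable (P : Params) {o : Type*} [Fintype o] [DecidableEq o] {G : Type*} [GaugeGroup G]

/-- [folklore] **THE DEPTH DISC (letters (1), (2′), (3) of W-22′'s `FineFieldChart` for ONE centre `U` and ONE direction, EXISTENTIAL radius).**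
Under α's displayed hypotheses — `ℰ.δ ≤ 1∕3`, `ι` unitary-valued with `‖ι g − 1‖ = dist1 g`, the loop-average reading `hE`, and the field's
smallness at every level `< K` of its real averaging tower — for every `ϱ > 0` there is a rescaling `r > 0` of the direction `H` such that the
tower chart coordinate `towerCoord P ℰ ι U (r • H)` (i) vanishes at `0`, (ii) is `DiffContOnCl ℂ` on `ball 0 1`, (iii) maps `closedBall 0 1`
into `ball 0 ϱ`.  Proof: α's `analyticAt_towerCoord_zero` + `towerCoord_zero` feed §1, and §2 identifies the rescaled germ. -/
theorem exists_rescale_towerCoord (ℰ : LoopAverage G) (hδ : ℰ.δ ≤ 1 / 3) (ι : G →* Matrix o o ℂ) (hι : ∀ g, ι g ∈ Matrix.unitaryGroup o ℂ)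
    (hdist : ∀ g : G, ‖ι g - 1‖ = dist1 g)
    (hE : ∀ {m : ℕ} (W : Fin (m + 1) → G), (∀ i, dist1 (W i) < ℰ.δ) → ι (ℰ.E W) = eml fun i => ι (W i)) (U : GaugeField P 0 G)
    (H : PBond P 0 → Matrix o o ℂ) (hsmall : ∀ j < P.K, ∀ c, Small ℰ (Averaging.iter (fun _ => blockAvg ℰ) j U) c) {ϱ : ℝ} (hϱ : 0 < ϱ) :
    ∃ r : ℝ, 0 < r ∧ towerCoord P ℰ ι U (fun b => (r : ℂ) • H b) 0 = 0 ∧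
      DiffContOnCl ℂ (towerCoord P ℰ ι U (fun b => (r : ℂ) • H b)) (ball 0 1) ∧
      MapsTo (towerCoord P ℰ ι U (fun b => (r : ℂ) • H b)) (closedBall 0 1) (ball 0 ϱ) := by
  obtain ⟨r, hr, hd, hm⟩ := exists_rescale_of_analyticAt_zero (analyticAt_towerCoord_zero ℰ hδ ι hι hdist hE U H hsmall)
    (towerCoord_zero ℰ hδ ι hι hdist hE U H hsmall) hϱ
  have e : towerCoord P ℰ ι U (fun b => (r : ℂ) • H b) = fun z => towerCoord P ℰ ι U H ((r : ℂ) * z) :=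
    funext fun z => towerCoord_smul P ι ℰ U H r z
  refine ⟨r, hr, towerCoord_zero ℰ hδ ι hι hdist hE U _ hsmall, ?_, ?_⟩
  · rw [e]; exact hd
  · rw [e]; exact hm

/-- [folklore] **THE QUANTITATIVE COMPANION** (for a later quantitative radius): whenever the `R`-tower of the slice is within `1∕2` of the averaging
tower of record in the Pi-sup norm, the chart coordinate is at most twice that distance (W-24a `norm_logChartT_le_two_mul_norm_sub` at the
UNITARY tower of record). -/
theorem norm_towerCoord_le_two_mul (ℰ : LoopAverage G) (ι : G →* Matrix o o ℂ) (hι : ∀ g, ι g ∈ Matrix.unitaryGroup o ℂ) (U : GaugeField P 0 G)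
    (H : PBond P 0 → Matrix o o ℂ) {z : ℂ} (hz : ‖(towerSlice P ι U H z).1 - towerDataOf P ι (fun _ => blockAvg ℰ) U‖ ≤ 1 / 2) :
    ‖towerCoord P ℰ ι U H z‖ ≤ 2 * ‖(towerSlice P ι U H z).1 - towerDataOf P ι (fun _ => blockAvg ℰ) U‖ :=
  norm_logChartT_le_two_mul_norm_sub P (fun k ν i => by
    rw [towerDataOf, SubstrateBackgroundTransporters.transV_apply]; exact hι _) hz

end Disc

/-! ### The `SU(n)` discharge: every hypothesis PROVED but the field's levelwise smallness -/

section DiscSU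

variable (P : Params) {n : Type} [Fintype n] [DecidableEq n] [Nonempty n]

/-- [folklore] **THE DEPTH DISC, `SU(n)`**: at `ℰ := expMeanLogSU`, `ι := fundamentalRep n`, for a fine `SU(n)` field small at every level `< K`
of its (0.4) averaging tower and every `ϱ > 0`, some rescaled direction `r • H` gives a tower chart coordinate that vanishes at `0`, is
`DiffContOnCl ℂ` on the unit disc and maps the closed unit disc into `ball 0 ϱ`. -/
theorem exists_rescale_towerCoord_SU (U : GaugeField P 0 (Matrix.specialUnitaryGroup n ℂ)) (H : PBond P 0 → Matrix n n ℂ)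
    (hsmall : ∀ j < P.K, ∀ c, Small (expMeanLogSU (n := n)) (Averaging.iter (fun _ => blockAvg (expMeanLogSU (n := n))) j U) c)
    {ϱ : ℝ} (hϱ : 0 < ϱ) :
    ∃ r : ℝ, 0 < r ∧ towerCoord P (expMeanLogSU (n := n)) (fundamentalRep n) U (fun b => (r : ℂ) • H b) 0 = 0 ∧
      DiffContOnCl ℂ (towerCoord P (expMeanLogSU (n := n)) (fundamentalRep n) U (fun b => (r : ℂ) • H b)) (ball 0 1) ∧
      MapsTo (towerCoord P (expMeanLogSU (n := n)) (fundamentalRep n) U (fun b => (r : ℂ) • H b)) (closedBall 0 1) (ball 0 ϱ) :=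
  exists_rescale_towerCoord P (expMeanLogSU (n := n)) expMeanLogSU_δ_le_third (fundamentalRep n) (fun g => fundamentalRep_mem_unitaryGroup g)
    (fun _ => rfl) (fun W hW => fundamentalRep_expMeanLogSU_E W hW) U H hsmall hϱ

end DiscSU

end Summit.QuantumFields.BalabanUV.T4Continuum.SubstrateComplexAvgTowerDisc

end
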